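import Literature.MathematicalPhysics.QuantumLattice.HeisenbergOrderNeelThermalSpinHalf
import Literature.MathematicalPhysics.QuantumLattice.HeisenbergOrderNeelHolds
import Literature.MathematicalPhysics.QuantumLattice.XYOrderIntegralDimProofs
import Literature.MathematicalPhysics.QuantumLattice.XYOrderRiemannSumProofs
import HarnessLib

/-!
# Néel order of the Heisenberg antiferromagnet in every dimension `d ≥ 3`, every spin — ground
# state (Kennedy–Lieb–Shastry) and low temperature (Dyson–Lieb–Simon, Theorem 6.2 with
# "`S = 1/2` and `ν` sufficiently large" made explicit: `ν ≥ 3`)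

Sibling proof file of `HeisenbergOrder.lean` (named facts `dyson_lieb_simon`: `d ≥ 3`, `S ≥ 1`;
`kennedy_lieb_shastry_ground`: `d = 3`, `S ≥ ½` or `d = 2`, `S ≥ 1`),
`HeisenbergOrderNeelHolds.lean` and `HeisenbergOrderNeelThermalSpinHalf.lean` (`d = 3`, `S = ½`,
low temperature). No named fact is introduced; 0 `sorry`; trust base Mathlib's three axioms.

## What is printed, and what this file assembles

* [KLS1988JSP] Theorem (p. 1022): ground-state Néel order for `d = 3`, `S = ½` (the KLS integral
  `∫ d³q (E_q/E_{q-Q})^{1/2} ⅓(-Σcos qᵢ)₊ = 0.35 < 2S/√6`), p. 1020: `d = 2`, `S ≥ 1`, and the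
  remark that the ground-state techniques "may be combined with the techniques of Dyson et al.
  for nonzero temperatures".
* [DLS1978] Theorem 6.2 (p. 364): "The nearest neighbor, simple cubic antiferromagnet has a phase
  transition at sufficiently low temperature if `ν ≥ 3`, `S = 1, 3/2, …` or if `S = 1/2` and `ν` is
  sufficiently large" (the size of `ν` for `S = ½` is left open there: "there is a need for better
  rigorous bounds to be certain that (62) fails for `ν = 3`, `S = 1/2` and to check the `ν` for
  which (62) holds when `S = 1/2`").
* [KLS1988PRL] after eq. (8) (pp. 2583–2584), about the SAME lattice integral `I(ν)` (the tree's
  `klsIntegral`, shared by the XY and the Heisenberg files): "We shall now prove that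
  `I(ν) ≤ I(2)` for `ν ≥ 3` … Since `F` is convex … By the same analysis one can also prove that
  `I(ν) ≤ I(μ)` whenever `ν > μ`" — in the tree: `klsIntegral_antitone`
  (`XYOrderIntegralDimProofs.lean`), together with sums → integrals `klsRiemannSum_tendsto_holds`
  (`XYOrderRiemannSumProofs.lean`).

COROLLARY ASSEMBLED HERE (two printed statements of the same authors plus the tree's certified
`d = 3` numerics; not printed in one place for `d ≥ 4`, `S = ½`): since `I(d) ≤ I(3) < 1/√6` for
every `d ≥ 3` (`klsIntegral_lt_of_three_le`, from `klsIntegral_antitone`, `klsRiemannSum_tendsto`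
and the certified `klsRiemannSum_three_eventually_le`: `R_L(3) ≤ 2/5` eventually), the punctured
Riemann sums satisfy `R_L(d) ≤ ρ_d < 1/√6 ≤ 2S/√6` eventually for every `d ≥ 3`
(`klsRiemannSum_eventually_le_of_three_le`), which is exactly the numerical hypothesis of BOTH
tree criteria — the ground-state one `heis_neelOrder_of_infraredBound` (with the unconditional
`T = 0` infrared bound `heis_infraredBound`) and the positive-temperature one
`heis_thermalNeelOrder_of_riemannSum`. Hence, for the spin-`S` Heisenberg antiferromagnet
`J Σ_{⟨xy⟩} 𝐒_x·𝐒_y` (`J > 0`) on the even tori `(ℤ/2kℤ)^d`: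

* `heisenbergAF_ground_neelOrder_of_three_le` — **every `d ≥ 3`, every `S ≥ ½`: Néel long-range
  order in the (tracial) ground state** (`HasStaggeredEvenTorusLRO` of `groundStateSpinCorrTorus`);
  `kennedy_lieb_shastry_ground_allDims` — the named fact's statement with `d = 3` widened to
  `3 ≤ d` (and `d = 2`, `S ≥ 1` kept);
* `heisenbergAF_thermal_neelOrder_of_three_le` — **every `d ≥ 3`, every `S ≥ ½`: Néel long-range
  order at low temperature** (`∃ β₀ > 0, ∀ β ≥ β₀, HasStaggeredEvenTorusLRO (spinSpinCorrTorus β)`);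
  `dyson_lieb_simon_allSpins` — the named fact `dyson_lieb_simon` with `2 ≤ n` widened to `1 ≤ n`,
  i.e. [DLS1978] Thm. 6.2 with "`ν` sufficiently large" = `ν ≥ 3`.

Not covered (and open): `d = 2`, `S = ½`, ground state (`I(2) = 0.65 > 1/√6`, barrier
`Literature.Barriers.HubbardSuperconductivity.InfraredBoundNeelSpinHalf2D`); `d ≤ 2`, `T > 0`
(no order: `mermin_wagner_staggered_holds`).

## References

* [KLS1988JSP] T. Kennedy, E. H. Lieb, B. S. Shastry, J. Stat. Phys. 53 (1988) 1019–1030,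
  Theorem p. 1022 and p. 1020.
* [KLS1988PRL] T. Kennedy, E. H. Lieb, B. S. Shastry, Phys. Rev. Lett. 61 (1988) 2582–2584,
  the paragraph after eq. (8).
* [DLS1978] F. J. Dyson, E. H. Lieb, B. Simon, J. Stat. Phys. 18 (1978) 335–383, Thm. 6.2 and
  §7 (dimensional dependence).
-/

noncomputable section

open Filter Topology
open Literature.MathematicalPhysics.QuantumLattice Literature.Probability.LatticeModels

namespace Literature.MathematicalPhysics.QuantumLattice

variable {d : ℕ}

/-- **`I(3) < 1/√6`**: the three-dimensional KLS integral lies below the spin-½ threshold — the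
limit form of the certified finite-volume bound `klsRiemannSum_three_eventually_le`
(`R_L(3) ≤ 2/5` eventually) through sums → integrals (`klsRiemannSum_tendsto_holds`).
KLS p. 1022: the integral "equals `0.0824 (e₀)^{1/2}`", i.e. `I(3) = 0.0824·√18 = 0.35 < 0.408`.
[cite: KLS1988JSP, Theorem p. 1022] -/
theorem klsIntegral_three_lt : klsIntegral 3 < 1 / Real.sqrt 6 := by
  obtain ⟨ρ, hρ, hev⟩ := klsRiemannSum_three_eventually_le
  have ht := klsRiemannSum_tendsto_holds 3 (by norm_num)
  exact (le_of_tendsto ht hev).trans_lt hρ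

/-- **`I(d) < 1/√6` for every `d ≥ 3`**, by the monotonicity of the KLS integral in the dimension
("By the same analysis one can also prove that `I(ν) ≤ I(μ)` whenever `ν > μ`";
`klsIntegral_antitone`) and `klsIntegral_three_lt`.
[cite: KLS1988PRL, after eq. (8)] [cite: KLS1988JSP, Theorem p. 1022] -/
theorem klsIntegral_lt_of_three_le (hd : 3 ≤ d) : klsIntegral d < 1 / Real.sqrt 6 :=
  (klsIntegral_antitone (by norm_num) hd).trans_lt klsIntegral_three_lt

/-- **The numerical hypothesis of the KLS criteria holds in every dimension `d ≥ 3`**: there is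
`ρ < 1/√6` with `R_L(d) ≤ ρ` for all large `L` (sums → integrals, `klsRiemannSum_tendsto_holds`,
and `klsIntegral_lt_of_three_le`; `ρ = (I(d) + 1/√6)/2`).
[cite: KLS1988PRL, after eq. (8)] [cite: KLS1988JSP, Theorem p. 1022] -/
theorem klsRiemannSum_eventually_le_of_three_le (hd : 3 ≤ d) :
    ∃ ρ : ℝ, ρ < 1 / Real.sqrt 6 ∧ ∀ᶠ L : ℕ in atTop, klsRiemannSum d L ≤ ρ := by
  have hI := klsIntegral_lt_of_three_le hd
  have hmid : klsIntegral d < (klsIntegral d + 1 / Real.sqrt 6) / 2 := by linarith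
  refine ⟨(klsIntegral d + 1 / Real.sqrt 6) / 2, by linarith, ?_⟩
  have ht := klsRiemannSum_tendsto_holds d (by omega)
  exact (ht.eventually (eventually_lt_nhds hmid)).mono fun L hL => hL.le

/-- The same bound against the spin-`S` threshold `2S/√6 = n/√6`, `n ≥ 1`. [cite: KLS1988JSP, Theorem p. 1022] -/
theorem klsRiemannSum_eventually_le_spin (hd : 3 ≤ d) {n : ℕ} (hn : 1 ≤ n) :
    ∃ ρ : ℝ, ρ < n / Real.sqrt 6 ∧ ∀ᶠ L : ℕ in atTop, klsRiemannSum d L ≤ ρ := by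
  obtain ⟨ρ, hρ, hev⟩ := klsRiemannSum_eventually_le_of_three_le hd
  exact ⟨ρ, hρ.trans_le
    (div_le_div_of_nonneg_right (by exact_mod_cast hn) (Real.sqrt_nonneg _)), hev⟩

/-- **Ground-state Néel order in every dimension `d ≥ 3`, every spin `S = n/2 ≥ ½`** (Kennedy–
Lieb–Shastry's `d = 3` theorem carried to all `d ≥ 3` by their own monotonicity remark on `I(ν)`):
for `J > 0` the tracial ground states of `J Σ_{⟨xy⟩} 𝐒_x·𝐒_y` on the even tori `(ℤ/2kℤ)^d` have
`liminf_k |Λ|⁻² Σ_{x,y} (-1)^{x+y} ⟨𝐒_x·𝐒_y⟩_{GS} > 0`. Inputs: the unconditional `T = 0` infrared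
bound `heis_infraredBound`, the criterion `heis_neelOrder_of_infraredBound`, and
`klsRiemannSum_eventually_le_spin`. COROLLARY of the two cited printed statements; for `d ≥ 4`,
`S = ½` not printed in one place. [cite: KLS1988JSP, Theorem p. 1022] [cite: KLS1988PRL, after eq. (8)] -/
theorem heisenbergAF_ground_neelOrder_of_three_le (hd : 3 ≤ d) {n : ℕ} (hn : 1 ≤ n) {J : ℝ}
    (hJ : 0 < J) :
    HasStaggeredEvenTorusLRO (fun L x y => groundStateSpinCorrTorus (d := d) L n J x y) :=
  heis_neelOrder_of_infraredBound (by omega) hn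
    (fun k hk q hq => heis_infraredBound (by omega) n k hk q hq)
    (klsRiemannSum_eventually_le_spin hd hn) hJ

/-- **Kennedy–Lieb–Shastry, all dimensions**: the statement of the named fact
`kennedy_lieb_shastry_ground` with its clause `d = 3 ∧ 1 ≤ n` widened to `3 ≤ d ∧ 1 ≤ n`
(the clause `d = 2 ∧ 2 ≤ n` is the tree theorem `kennedy_lieb_shastry_ground_holds`).
[cite: KLS1988JSP, Theorem p. 1022 and p. 1020] [cite: KLS1988PRL, after eq. (8)] -/
theorem kennedy_lieb_shastry_ground_allDims :
    ∀ (d n : ℕ) (_h : 3 ≤ d ∧ 1 ≤ n ∨ d = 2 ∧ 2 ≤ n) (J : ℝ) (_hJ : 0 < J),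
      HasStaggeredEvenTorusLRO (fun L x y => groundStateSpinCorrTorus (d := d) L n J x y) := by
  rintro d n (⟨hd, hn⟩ | ⟨rfl, hn⟩) J hJ
  · exact heisenbergAF_ground_neelOrder_of_three_le hd hn hJ
  · exact kennedy_lieb_shastry_ground_holds 2 n (Or.inr ⟨rfl, hn⟩) J hJ

/-- **Néel order at low temperature in every dimension `d ≥ 3`, every spin `S = n/2 ≥ ½`**: for
`J > 0` there is `β₀ > 0` such that for all `β ≥ β₀` the Gibbs states of `J Σ_{⟨xy⟩} 𝐒_x·𝐒_y` on
the even tori `(ℤ/2kℤ)^d` have Néel long-range order (`HasStaggeredEvenTorusLRO` of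
`spinSpinCorrTorus β`). The positive-temperature KLS criterion `heis_thermalNeelOrder_of_riemannSum`
(the Dyson–Lieb–Simon route in the KLS arrangement) fed with `klsRiemannSum_eventually_le_spin`.
For `S ≥ 1` this is [DLS1978] Thm. 6.2; for `S = ½` it settles the clause "`ν` sufficiently
large" of that theorem as `ν ≥ 3` (`d = 3`: [KLS1988JSP] p. 1020 remark,
`heisenbergAF_spinHalf_cubic_thermalNeelOrder`; `d ≥ 4`: by [KLS1988PRL]'s monotonicity of `I(ν)`;
not printed in one place). [cite: DLS1978, Thm. 6.2] [cite: KLS1988JSP, p. 1020 (remark)]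
[cite: KLS1988PRL, after eq. (8)] -/
theorem heisenbergAF_thermal_neelOrder_of_three_le (hd : 3 ≤ d) {n : ℕ} (hn : 1 ≤ n) {J : ℝ}
    (hJ : 0 < J) :
    ∃ β₀ : ℝ, 0 < β₀ ∧ ∀ β : ℝ, β₀ ≤ β →
      HasStaggeredEvenTorusLRO (fun L x y => spinSpinCorrTorus (d := d) β L n J x y) :=
  heis_thermalNeelOrder_of_riemannSum hd hn (klsRiemannSum_eventually_le_spin hd hn) hJ

/-- **Dyson–Lieb–Simon, Theorem 6.2, all spins**: the statement of the named fact
`dyson_lieb_simon` (`d ≥ 3`, `2 ≤ n`) with `2 ≤ n` widened to `1 ≤ n` — "if `ν ≥ 3`,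
`S = 1, 3/2, …` or if `S = 1/2` and `ν` is sufficiently large", with `ν ≥ 3` sufficing.
[cite: DLS1978, Thm. 6.2] [cite: KLS1988JSP, p. 1020 (remark)] [cite: KLS1988PRL, after eq. (8)] -/
theorem dyson_lieb_simon_allSpins :
    ∀ (d : ℕ) (_hd : 3 ≤ d) (n : ℕ) (_hn : 1 ≤ n) (J : ℝ) (_hJ : 0 < J),
      ∃ β₀ : ℝ, 0 < β₀ ∧ ∀ β : ℝ, β₀ ≤ β →
        HasStaggeredEvenTorusLRO (fun L x y => spinSpinCorrTorus (d := d) β L n J x y) :=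
  fun _d hd _n hn _J hJ => heisenbergAF_thermal_neelOrder_of_three_le hd hn hJ

end Literature.MathematicalPhysics.QuantumLattice
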